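import Summits.BirchSwinnertonDyer.BirchSwinnertonDyer.Theorems.ErratumRoadFiveNonSurjCornerHybridRoadB
import Summits.BirchSwinnertonDyer.BirchSwinnertonDyer.Theorems.ErratumRoadFiveNonSurjCornerAuxPrimeSupplyOfRangeK
import HarnessLib

/-!
# Route `ErratumRoadFive` (rung K2), crux `NonSurjCorner` (item stmt-BirchSwinnertonDyer-19065), line `Lines/hybrid.lean`:
# GLUE #25 — composition of the r23 skeleton candidate: FIVE stubs {deep witness, twin-lower supplies, fifteen facts, 2 + 5 names, K-DISJOINTNESS};
# the identity-component label (B6), LAB′ and the Chebotarev–Kummer supply are all DERIVED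
# (cell `bsd-stepL`, seat `bsd-stepL-corner-p1` g18; `--supports stmt-BirchSwinnertonDyer-19065 --as helper`)

WHY THIS FILE. `…AuxPrimeSupplyOfRangeK` derives the corner auxiliary-prime supply from K-disjointness (K); plugging it into glue #24 (`…HybridRoadB`)
gives the composition of r23, whose slot 6‴ is (K) on the corner's inert frames: for `K` imaginary quadratic with `p` inert and unramified, every value of
`ρ̄_{E,p}` on `Γ_ℚ` is taken on `res Γ_K`. (K) is elementary (memo CORNER-G18 §6: the index-2 alternative forces `K` = the Cartan field or the
`χ_C·λ`-field, excluded by `p` inert resp. unramified); it is the LAST piece between 19065's Euler half and print + tree theorems on slot 6.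
* `nonSurjCorner_of_deepWitness_of_twinLowerSupply_of_fifteenFacts_of_twoPlusFiveNamedInputs_of_KDisjoint_pAnchor`.

HONEST FRAMING: ONE THEOREM (no definition, no named fact, no `sorry`); CONDITIONAL on every displayed binder; no stub proved; 19065 NOT closed by this
file; nothing about any curve's BSD; BSD is not advanced; T7.
References (locators only): [cite: GrossLMS1991, §3, §6, §9] [cite: Serre1972, §2] [cite: Zywina2015, §1.3] [cite: Kato2004Asterisque, Thm. 12.4]
[cite: Cha2005, Thm. 21] [cite: PastenShimura2024, Lemma 6.18] [cite: Miller2011LMS, Def. 1.1].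
-/

set_option autoImplicit false
set_option linter.dupNamespace false -- `Summit.BirchSwinnertonDyer.BirchSwinnertonDyer` (summit = problem), tree-wide

noncomputable section

open scoped Classical NumberField Pointwise MatrixGroups ModularForm

namespace Summit.BirchSwinnertonDyer.BirchSwinnertonDyer.Theorems

open CongruenceSubgroup WeierstrassCurve NumberField IsDedekindDomain Field Rat.HeightOneSpectrum
  Literature.NumberTheory.EllipticCurves
  Literature.NumberTheory.EllipticCurves.ModularForms
  Literature.NumberTheory.Automorphic
  Literature.NumberTheory.EllipticCurves.Rank1Residual
  Literature.NumberTheory.EllipticCurves.Rank1Residual.Typed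
  Literature.NumberTheory.EllipticCurves.Wuthrich2014
  Literature.NumberTheory.EllipticCurves.SteinWuthrich2013
  Literature.NumberTheory.EllipticCurves.Greenberg1999
  Literature.NumberTheory.EllipticCurves.Kato2004
  Literature.NumberTheory.EllipticCurves.BarriosEtAl2025
  Literature.NumberTheory.EllipticCurves.EmertonPollackWeston2006
  Literature.NumberTheory.EllipticCurves.ShimuraCMFamily
  Literature.NumberTheory.GaloisRepresentations Literature.NumberTheory.GaloisCohomology
  Summit.BirchSwinnertonDyer.Rank1Residual
  Summit.BirchSwinnertonDyer.Rank1Residual.X11b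
  Summit.BirchSwinnertonDyer.Rank1Residual.X11b.Three.Koly
  Summit.BirchSwinnertonDyer.BirchSwinnertonDyer.Theses.ErratumRoadFive

/-! ### Glue #25 -/

/-- **GLUE #25 — glue #24 with slot 6″ (the corner auxiliary-prime supply) DERIVED from K-DISJOINTNESS** (`AuxPrimeSupplyCorner.cornerAuxPrimeSupply_of_rangeK`,
this seat: (L0) + lane B's exact images + (T) + (L1) + (L2)). Binders: `hWit` (slot 1′) → `hSup2` (slot 2″) → `hF3` (fifteen facts) → hMax2 → hShim5 (five names) →
`hKD` (slot 6‴: K-disjointness on the inert frames — `K ⊄ ℚ(E[p])`, a classical statement; FALSE for the Cartan field, TRUE when `p` is inert and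
unramified in `K`, the remaining local-at-`p` lemma) → `NonSurjCorner`. Item 27982, LAB′ and the aux supply are NOT binders. CONDITIONAL; 19065 NOT
closed; nothing booked; T7. [cite: GrossLMS1991, §9] [cite: Serre1972, §2.2, §2.6] [cite: Zywina2015, Thm. 1.4] -/
theorem nonSurjCorner_of_deepWitness_of_twinLowerSupply_of_fifteenFacts_of_twoPlusFiveNamedInputs_of_KDisjoint_pAnchor
    -- slot 1′ (r19): ONE DEEP WITNESS per deep corner pair (slots 1 + 2b of r18 merged, ∃-recut)
    (hWit : ∀ (W : WeierstrassCurve ℚ) [W.IsElliptic] [W.IsGloballyMinimal] (p : ℕ) [Fact p.Prime],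
        ClassX11b W p → ¬ Surj W p → (p = 5 ∨ p = 7) → p ∣ padicValInt p W.minimalDiscriminantInt →
        ¬ Ram W p → (∃ s : ℚ, shaAn W = (s : ℂ) ∧ 0 < padicValRat p s) →
        ∃ (N : ℕ) (_ : NeZero N) (K : Type) (_ : Field K) (_ : NumberField K)
          (Dt : ModularParametrizationData W N) (H : HeegnerDatum N (NumberField.discr K)) (ι : K →+* ℂ)
          (P : (W.baseChange K).toAffine.Point),
          W.conductorNorm ℤ = N ∧ IsImaginaryQuadratic K ∧ 4 < (NumberField.discr K).natAbs ∧
          SatisfiesHeegnerHypothesis N K ∧ (W.quadraticTwist (NumberField.discr K : ℚ)).entireLFunction 1 ≠ 0 ∧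
          WeierstrassCurve.Affine.Point.map ι.toRatAlgHom P = heegnerPointComplex Dt H ∧ ¬ (p : ℤ) ∣ Dt.c ∧
          ((∃ (d₁ : KolyvaginHeegnerData Dt H.β ι 1) (y : (W.baseChange K).toAffine.Point),
              WeierstrassCurve.Affine.Point.map (W' := W) (algebraMap K (ringClassField K ι 1)).toRatAlgHom y =
                d₁.derivedPoint ∧
              ∃ Q : (W.baseChange K).toAffine.Point, ((p ^ (padicValNat p W.tamagawaProduct + 1) : ℕ) : ℤ) • Q = y) →
            ∃ M : ℕ, M ≤ padicValNat p W.tamagawaProduct ∧ CertificateAt Dt H.β ι p M) ∧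
          (∀ (Wd : WeierstrassCurve ℚ) [Wd.IsElliptic] [Wd.IsGloballyMinimal] (Cd : VariableChange ℚ),
            Cd • W.quadraticTwist (NumberField.discr K : ℚ) = Wd →
            ClassX11a Wd p → ¬ Surj Wd p → p ∣ padicValInt p Wd.minimalDiscriminantInt →
            ∀ {N : ℕ} [NeZero N] (f : CuspForm (Gamma0 N) 2), IsNewformOf Wd f →
            ∀ (ϖ : ℚ), (ϖ : ℝ) * Wd.realPeriodRat = plusPeriod f →
            ∀ (a : ℚ_[p]) (L : PowerSeries ℚ_[p]),
              (Wd.HasSplitMultiplicativeReductionAtPrime p → a = 1) →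
              (¬ Wd.HasSplitMultiplicativeReductionAtPrime p → a = -1) →
              IsMultPAdicLFunctionOf f p a L →
              ∃ n : ℕ, ‖PowerSeries.coeff n (PowerSeries.C ((ϖ : ℚ) : ℚ_[p]) * L)‖ = 1))
    -- slot 2″ (r20): the twin-lower SUPPLIES of every corner pair (∃-shape): inert frames (`FHTwinLowerSupplyAt`) ∧ the MAX frame
    (hSup2 : ∀ (W : WeierstrassCurve ℚ) [W.IsElliptic] [W.IsGloballyMinimal] (p : ℕ) [Fact p.Prime],
        ClassX11b W p → ¬ Surj W p → (p = 5 ∨ p = 7) → p ∣ padicValInt p W.minimalDiscriminantInt → ¬ Ram W p →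
        FHTwinLowerSupplyAt W p ∧
        (∃ (K : Type) (_ : Field K) (_ : NumberField K), IsImaginaryQuadratic K ∧ 4 < (NumberField.discr K).natAbs ∧
          SatisfiesHeegnerHypothesis (W.conductorNorm ℤ) K ∧ SatisfiesHeegnerHypothesis 2 K ∧
          (W.quadraticTwist (NumberField.discr K : ℚ)).entireLFunction 1 ≠ 0 ∧
          ∀ (Wd : WeierstrassCurve ℚ) [Wd.IsElliptic] [Wd.IsGloballyMinimal] (Cd : VariableChange ℚ),
            Cd • W.quadraticTwist (NumberField.discr K : ℚ) = Wd → ¬ Surj Wd p → Typed.MissingLowerBoundAt Wd p))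
    -- slot 3 (r14): FIFTEEN named facts — r11–r13's sixteen minus conjunct 16 (Cha 2005 Rmk. 25 upper, discharged inside on the corner)
    (hF3 :
      (∀ (N : ℕ) [NeZero N] (W : WeierstrassCurve ℚ) (K : Type) [Field K] [NumberField K], Literature.NumberTheory.EllipticCurves.gross_zagier N W K) ∧
      (∀ (N : ℕ) [NeZero N] (W : WeierstrassCurve ℚ) (K : Type) [Field K] [NumberField K], Literature.NumberTheory.EllipticCurves.kolyvagin N W K) ∧
      Literature.NumberTheory.EllipticCurves.Wuthrich2014.sha_dvd_analyticSha ∧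
      Literature.NumberTheory.EllipticCurves.rank_eq_analyticRank_of_analyticRank_le_one ∧
      Literature.NumberTheory.EllipticCurves.ModularForms.exists_isNewformOf ∧
      Literature.NumberTheory.EllipticCurves.friedbergHoffstein_exists_heegnerField_split_twist_ne_zero ∧
      Literature.NumberTheory.EllipticCurves.ModularForms.mazur_not_dvd_maninConstant_of_odd ∧
      Literature.NumberTheory.EllipticCurves.SteinWuthrich2013.thm61_splitMultiplicative ∧
      Literature.NumberTheory.EllipticCurves.SteinWuthrich2013.thm61_nonsplitMultiplicative ∧
      (∀ (W : WeierstrassCurve ℚ) [W.IsElliptic] [W.IsGloballyMinimal] (p : ℕ) [Fact p.Prime], Literature.NumberTheory.EllipticCurves.greenberg_stevens (W := W) (p := p)) ∧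
      Literature.NumberTheory.EllipticCurves.Cha2005.rmk25_pow_dvd_card_sha_primary_of_certificate ∧
      Literature.NumberTheory.EllipticCurves.Kato2004.thm12_4 ∧
      Literature.NumberTheory.EllipticCurves.Kato2004.exists_multDivisibilityInputs_nonsplit_contra ∧
      Literature.NumberTheory.EllipticCurves.Kato2004.exists_multDivisibilityInputs_split_contra ∧
      Literature.NumberTheory.EllipticCurves.Kato2004.exists_multDivisibilityInputs_fine_contra)
    -- slot 4 (r7): the six Hida-side NAMED facts of x11a's non-surjective chain
    -- slot 5, conjunct 1 (r16): TWO names — Poitou–Tate for Selmer structures is a tree theorem (selmerComplement_canonical_holds)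
    (hMax2 : GrossLMS1991.prop37_2_frobeniusCongruence ∧ Gross1991_heegnerPoint_sub_ratTorsion_mem_E0_imageFree)
    -- slot 5, conjunct 2 (r22): FIVE Shimura names — the PRINTED CM primitives for irreducible images are back (they carry the labels)
    (hShim5 : friedbergHoffstein_exists_twist_ne_zero_inertAt ∧ nonempty_shimuraParametrizationData ∧
      PastenShimura2024_componentOrders ∧
      (∀ (K : Type) [Field K] [NumberField K], casselsTate_levelInputs K) ∧
      shimuraCurve_heegnerSystem_primitivesFromFiveIrr)
    -- slot 6‴ (r23): K-DISJOINTNESS on the corner's inert frames — every value of `ρ̄_{E,p}` on `Γ_ℚ` is taken on `res Γ_K`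
    (hKD : ∀ (W : WeierstrassCurve ℚ) [W.IsElliptic] [W.IsGloballyMinimal] (p : ℕ) [Fact p.Prime],
      ClassX11b W p → ¬ Surj W p → (p = 5 ∨ p = 7) →
      ∀ (K : Type) [Field K] [NumberField K], IsImaginaryQuadratic K →
        ((Ideal.span {(p : ℤ)}).primesOver (𝓞 K)).ncard = 1 → ¬ (p : ℤ) ∣ NumberField.discr K →
        ∀ σ : absoluteGaloisGroup ℚ, ∃ τ : absoluteGaloisGroup ℚ,
          τ ∈ (absGaloisRestrict ℚ K).range ∧ galoisRepTorsion W p τ = galoisRepTorsion W p σ) :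
    Summit.BirchSwinnertonDyer.BirchSwinnertonDyer.Theses.ErratumRoadFive.NonSurjCorner :=
  nonSurjCorner_of_deepWitness_of_twinLowerSupply_of_fifteenFacts_of_twoPlusFiveNamedInputs_of_cornerAuxSupply_pAnchor hWit hSup2 hF3
    hMax2 hShim5
    (fun W _ _ p _ hX hns h57 N K _ _ _ _hN hK hD hin hsp hpS q _ hqN hqS _hpc ↦
      AuxPrimeSupplyCorner.cornerAuxPrimeSupply_of_rangeK W p hX hns h57 K hK hD
        (hKD W p hX hns h57 K hK (hin p hpS).2.2.2.1 (hin p hpS).2.2.2.2) q (hsp q Fact.out hqN hqS) N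
        (fun h0 ↦ (hin p hpS).2.2.1 (h0 ▸ dvd_zero _)))

end Summit.BirchSwinnertonDyer.BirchSwinnertonDyer.Theorems

end
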